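/-
Copyright (c) 2026 the pub-hodgecm-mathlib formalisation cell (harness21).  Prover seat hodgecm-mathlib-K2E3-p17 (g11), HCML Track B «K2-LIT» ∕ h413
(`stmt-HodgeConjecture-24833`), R90-TF section S3, (U3-F) brick P4′ «irreducibility devices compatible with a PRESCRIBED constant term» (captain's
census `R90/S3/CENSUS-U3F-assembly.K2E3-p17-g11.md` §3 (C2); offered on the R90 bus 2026-09-05T00:39Z).  2026-09-05.
-/
import Summits.HodgeConjecture.HodgeConjecture.Theorems.R90S3IrreducibleOfIrreducibleMod   -- ★ P4: `exists_monic_irreducible_natDegree_eq`, Gauss heads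
import Mathlib.RingTheory.Polynomial.ScaleRoots         -- `Polynomial.scaleRoots`
import Mathlib.Algebra.Polynomial.SpecificDegree        -- `Monic.irreducible_iff_roots_eq_zero_of_degree_le_three`
import Mathlib.Algebra.Polynomial.Degree.SmallDegree    -- `Monic.eq_X_add_C`
import Mathlib.GroupTheory.OrderOfElement               -- `powCoprime`
import Mathlib.FieldTheory.Finite.Basic                 -- `ZMod.card_units`
import HarnessLib

/-!
# R90-TF · S3 · THEOREMS — `R90S3IrreduciblePrescribedConstant` ((U3-F) brick P4′): irreducible polynomials over a finite field with a PRESCRIBED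
# constant term (scaling device; quadratics by counting), and the TWO-PRIME DEGREE SIEVE forcing a monic integer polynomial to be irreducible

R90-TF section S3 (dealer R90-C12-plan (g2)); crux H413 (`stmt-HodgeConjecture-24833`, lane `--supports … --as helper`), route `HCCMUnconditional`.  Serves the
CRT step P3 (`PlantedPolynomial`) of the ℚ-PLANTED road behind `stub_R90_S3_auxGlobaliseField` (`Cruxes/H413/Lines/R90_S3_LocalTransportWaveG.lean` :645).
WHY (census (C0), (C2)): norm counting (★ P5 `R90S3UnitAwayFromPlantedPlace`) PINS the constant term `f(0) = pᵃ` of the planted `f ∈ ℤ[X]`, so the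
irreducibility condition «`f ≡ g (mod ℓ)` with `g` irreducible» (★ P4 `R90S3IrreducibleOfIrreducibleMod`) must be met by a `g` whose constant term is the residue
of `pᵃ` — a `g` with PRESCRIBED non-zero constant term.  This file supplies the devices: (i) SCALING `g ↦ scaleRoots g u` (constant term `× u^d`, irreducibility
kept), reaching every constant when `x ↦ x^d` is onto the units (e.g. `gcd(d, ℓ − 1) = 1`); (ii) irreducible QUADRATICS `X² + bX + c` exist for every `c ≠ 0`
over every finite field (the roots `r` of the reducible ones are non-zero and determine `b = −(r + c∕r)`, an image of the `q − 1` units — fewer than the `q`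
values of `b`); (iii) the TWO-PRIME DEGREE SIEVE: a monic `f ∈ ℤ[X]` whose reduction at one prime is `(linear)·(irreducible of degree d − 1)` and whose reduction
at another prime has NO ROOT is irreducible over `ℤ` and `ℚ` (a monic factorisation has degrees `{1, d−1}` by the first prime, and the linear factor would
give an integer root, visible at the second prime); with (ii) and ★ P4 both target shapes exist with any prescribed non-zero constant term (`d ≥ 2`, resp.
`d = 2` or `d ≥ 4`).  PURE MATHLIB + ★ P4; THEOREMS ONLY (no `def`, no `instance`, no notation, no named fact, no `sorry`); never imports `Cruxes/…/Lines`.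

* §1 `natDegree`∕`Monic`∕constant term of `scaleRoots` over a field, **`irreducible_scaleRoots`**.
* §2 **`exists_monic_irreducible_natDegree_eq_coeff_zero_eq_of_pow_surjective`** (finite field, `d ≥ 1`, `c ≠ 0`, `u ↦ u^d` onto `kˣ`), the coprime-exponent
  criterion `pow_units_surjective_of_coprime_card`, and the `ZMod ℓ` form **`exists_monic_irreducible_natDegree_eq_coeff_zero_eq_zmod`** (`Nat.Coprime d (ℓ − 1)`).
* §3 **`exists_irreducible_X_sq_add_C_mul_X_add_C`** (every finite field, `c ≠ 0`).
* §4 targets with prescribed constant term: **`exists_linear_mul_irreducible_coeff_zero_eq`** (`(X + C t)·h`, `h` irreducible of degree `d − 1`, `d ≥ 2`) and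
  **`exists_monic_no_root_coeff_zero_eq`** (monic of degree `d = 2` or `d ≥ 4` with no root).
* §5 THE SIEVE **`irreducible_of_map_eq_linear_mul_irreducible_of_forall_not_isRoot`** (over `ℤ`) and `irreducible_map_rat_of_map_eq_linear_mul_irreducible_of_forall_not_isRoot` (over `ℚ`).

HONEST LABEL: HC_CM is proved only modulo the 7 printed citations (2 remaining named inputs: hLiu418 = stmt-HodgeConjecture-24832, h413 =
stmt-HodgeConjecture-24833) until rung 0 closes; elementary algebra for a sub-step of a GENUINE residual ((U3-F)); proves nothing printed; count-neutral.

## References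
* [LidlNiederreiter1997] R. Lidl, H. Niederreiter, *Finite Fields*, 2nd ed. (1997), Ch. 3 §§1–2 (irreducible polynomials, their number; composition `f(x∕u)`).
* [CasselsFrohlichANT1967] J. W. S. Cassels, A. Fröhlich (eds.), *Algebraic Number Theory* (1967), Ch. II §6 (the CRT ∕ approximation consumer P3).
-/

set_option autoImplicit false
-- the mandated namespace repeats the single-problem summit's segment (`HodgeConjecture.HodgeConjecture`)
set_option linter.dupNamespace false

noncomputable section

namespace Summit.HodgeConjecture.HodgeConjecture.R90.S3

open Polynomial

/-! ## §1 Scaling the roots: `scaleRoots g u` over a field -/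

section Scale

variable {k : Type*} [Field k]

/-- The constant term of `scaleRoots g u` is `g(0) · u^{deg g}`. [folklore] -/
theorem coeff_zero_scaleRoots (g : k[X]) (u : k) : (g.scaleRoots u).coeff 0 = g.coeff 0 * u ^ g.natDegree := by
  rw [coeff_scaleRoots, Nat.sub_zero]

/-- **Scaling keeps irreducibility** (`u ≠ 0`): a factorisation of `scaleRoots g u` scales back by `u⁻¹` to one of `g` with the same degrees
(Mathlib `mul_scaleRoots_of_noZeroDivisors`, `scaleRoots_mul`, `natDegree_scaleRoots`). [cite: LidlNiederreiter1997, Ch. 3 §1] -/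
theorem irreducible_scaleRoots {g : k[X]} (hg : Irreducible g) {u : k} (hu : u ≠ 0) : Irreducible (g.scaleRoots u) := by
  have hg0 : g ≠ 0 := hg.ne_zero
  have hback : (g.scaleRoots u).scaleRoots u⁻¹ = g := by rw [← scaleRoots_mul, mul_inv_cancel₀ hu, scaleRoots_one]
  refine ⟨fun h => hg.not_isUnit ?_, fun a b hab => ?_⟩
  · -- a unit has degree `0`, and `scaleRoots` preserves the degree
    rw [isUnit_iff_degree_eq_zero] at h ⊢
    rwa [degree_scaleRoots] at h
  · have hab' : g = a.scaleRoots u⁻¹ * b.scaleRoots u⁻¹ := by rw [← hback, hab, mul_scaleRoots_of_noZeroDivisors]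
    rcases hg.isUnit_or_isUnit hab' with ha | hb
    · left
      rw [isUnit_iff_degree_eq_zero, degree_scaleRoots] at ha
      exact isUnit_iff_degree_eq_zero.mpr ha
    · right
      rw [isUnit_iff_degree_eq_zero, degree_scaleRoots] at hb
      exact isUnit_iff_degree_eq_zero.mpr hb

end Scale

/-! ## §2 Irreducible polynomials of prescribed degree AND prescribed constant term, when `u ↦ u^d` is onto the units -/

section Prescribed

variable (k : Type*) [Field k] [Finite k]

/-- An irreducible polynomial of degree `≥ 2` over a field has non-zero constant term (else `X ∣ g`). [folklore] -/
theorem coeff_zero_ne_zero_of_irreducible_of_two_le {K : Type*} [Field K] {g : K[X]} (hg : Irreducible g) (h2 : 2 ≤ g.natDegree) : g.coeff 0 ≠ 0 := by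
  intro h0
  have hX : (X : K[X]) ∣ g := X_dvd_iff.mpr h0
  have hdeg := degree_eq_one_of_irreducible_of_root hg (show g.IsRoot 0 by rwa [IsRoot, ← coeff_zero_eq_eval_zero])
  have : g.natDegree = 1 := natDegree_eq_of_degree_eq_some hdeg
  omega

/-- **Prescribed degree and constant term.**  Over a finite field `k` in which `u ↦ u^d` is onto `kˣ`, for every `d ≥ 1` and `c ≠ 0` there is a monic
irreducible `g` with `natDegree g = d` and `g(0) = c`: scale an irreducible of degree `d` (★ P4 `exists_monic_irreducible_natDegree_eq`) by `u` with
`u^d = c ∕ g₀(0)` (for `d = 1` take `X + c`). [cite: LidlNiederreiter1997, Ch. 3 §§1–2] -/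
theorem exists_monic_irreducible_natDegree_eq_coeff_zero_eq_of_pow_surjective {d : ℕ} (hd : d ≠ 0)
    (hsurj : Function.Surjective fun u : kˣ => u ^ d) {c : k} (hc : c ≠ 0) :
    ∃ g : k[X], g.Monic ∧ Irreducible g ∧ g.natDegree = d ∧ g.coeff 0 = c := by
  by_cases hd1 : d = 1
  · subst hd1
    refine ⟨X + C c, monic_X_add_C c, irreducible_of_degree_eq_one (degree_X_add_C c), natDegree_X_add_C c, by simp⟩
  have hd2 : 2 ≤ d := by omega
  obtain ⟨g₀, hm, hirr, hdeg⟩ := exists_monic_irreducible_natDegree_eq k d hd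
  have hg₀ : g₀.coeff 0 ≠ 0 := coeff_zero_ne_zero_of_irreducible_of_two_le hirr (hdeg ▸ hd2)
  obtain ⟨u, hu⟩ := hsurj (Units.mk0 (c / g₀.coeff 0) (div_ne_zero hc hg₀))
  have hu' : (u : k) ^ d = c / g₀.coeff 0 := by
    have := congrArg (fun x : kˣ => (x : k)) hu
    simpa using this
  refine ⟨g₀.scaleRoots u, (monic_scaleRoots_iff (u : k)).mpr hm, irreducible_scaleRoots hirr u.ne_zero, by rw [natDegree_scaleRoots, hdeg], ?_⟩
  rw [coeff_zero_scaleRoots, hdeg, hu', mul_div_cancel₀ _ hg₀]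

omit [Finite k] in
/-- If `gcd(#kˣ, d) = 1` then `u ↦ u^d` is a bijection of `kˣ` (Mathlib `powCoprime`), in particular onto. [folklore] -/
theorem pow_units_surjective_of_coprime_card {d : ℕ} (h : (Nat.card kˣ).Coprime d) : Function.Surjective fun u : kˣ => u ^ d := by
  intro c
  exact ⟨(powCoprime h).symm c, by simpa [powCoprime] using (powCoprime h).apply_symm_apply c⟩

/-- **`ZMod ℓ` form**: for a prime `ℓ`, `d ≥ 1` with `gcd(d, ℓ − 1) = 1` and `c ≠ 0` there is a monic irreducible `g ∈ (ℤ∕ℓ)[X]` of degree `d` with `g(0) = c`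
(e.g. `d = 3` and `ℓ ≡ 2 (mod 3)`). [cite: LidlNiederreiter1997, Ch. 3 §§1–2] -/
theorem exists_monic_irreducible_natDegree_eq_coeff_zero_eq_zmod (ℓ : ℕ) [hℓ : Fact ℓ.Prime] {d : ℕ} (hd : d ≠ 0) (hcop : d.Coprime (ℓ - 1))
    {c : ZMod ℓ} (hc : c ≠ 0) : ∃ g : (ZMod ℓ)[X], g.Monic ∧ Irreducible g ∧ g.natDegree = d ∧ g.coeff 0 = c := by
  refine exists_monic_irreducible_natDegree_eq_coeff_zero_eq_of_pow_surjective (ZMod ℓ) hd ?_ hc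
  apply pow_units_surjective_of_coprime_card
  rw [Nat.card_eq_fintype_card, ZMod.card_units ℓ]
  exact hcop.symm

end Prescribed

/-! ## §3 Irreducible quadratics with prescribed constant term (every finite field) -/

/-- **`X² + bX + c` is irreducible for some `b`** (finite field `k`, `c ≠ 0`).  A root `r` of `X² + bX + c` is non-zero (`c ≠ 0`) and then
`b = −(r + c r⁻¹)`; so the `b` with a root are images of the `#k − 1` units, and some `b ∈ k` is missed; a monic quadratic without roots is irreducible
(Mathlib `Monic.irreducible_iff_roots_eq_zero_of_degree_le_three`). [cite: LidlNiederreiter1997, Ch. 3 §2] -/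
theorem exists_irreducible_X_sq_add_C_mul_X_add_C (k : Type*) [Field k] [Finite k] {c : k} (hc : c ≠ 0) :
    ∃ b : k, Irreducible (X ^ 2 + C b * X + C c : k[X]) := by
  classical
  haveI := Fintype.ofFinite k
  let φ : kˣ → k := fun r => -((r : k) + c * (r : k)⁻¹)
  have hcard : (Finset.univ.image φ).card < (Finset.univ : Finset k).card := by
    calc (Finset.univ.image φ).card ≤ (Finset.univ : Finset kˣ).card := Finset.card_image_le
      _ = Fintype.card kˣ := Finset.card_univ
      _ < Fintype.card k := by rw [Fintype.card_units]; exact Nat.sub_lt Fintype.card_pos one_pos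
      _ = (Finset.univ : Finset k).card := Finset.card_univ.symm
  obtain ⟨b, -, hb⟩ := Finset.exists_mem_notMem_of_card_lt_card hcard
  refine ⟨b, ?_⟩
  have hdeg : (X ^ 2 + C b * X + C c : k[X]).natDegree = 2 := by compute_degree!
  have hmonic : (X ^ 2 + C b * X + C c : k[X]).Monic := by
    rw [Monic, leadingCoeff, hdeg]; simp
  rw [hmonic.irreducible_iff_roots_eq_zero_of_degree_le_three (by rw [hdeg]) (by rw [hdeg]; norm_num), Multiset.eq_zero_iff_forall_notMem]
  intro x hx
  rw [mem_roots hmonic.ne_zero, IsRoot.def] at hx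
  have hx' : x ^ 2 + b * x + c = 0 := by simpa using hx
  have hx0 : x ≠ 0 := by
    rintro rfl
    apply hc
    simpa using hx'
  apply hb
  refine Finset.mem_image.mpr ⟨Units.mk0 x hx0, Finset.mem_univ _, ?_⟩
  -- `b = −(x + c x⁻¹)` from `x² + b x + c = 0`
  have hx1 : x * x⁻¹ = 1 := mul_inv_cancel₀ hx0
  simp only [φ, Units.val_mk0]
  linear_combination (-x⁻¹) * hx' + (x + b) * hx1

/-! ## §4 Target shapes with prescribed non-zero constant term -/

section Targets

variable (k : Type*) [Field k] [Finite k]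

/-- **`(X + C t) · h` with `h` irreducible of degree `d − 1` and prescribed constant term** (`d ≥ 2`, any `c`): take any monic irreducible `h` of degree
`d − 1` with `h(0) ≠ 0` (★ P4; for `d − 1 = 1` use `X + 1`) and `t := c ∕ h(0)`. [cite: LidlNiederreiter1997, Ch. 3 §2] -/
theorem exists_linear_mul_irreducible_coeff_zero_eq {d : ℕ} (hd : 2 ≤ d) (c : k) :
    ∃ (t : k) (h : k[X]), h.Monic ∧ Irreducible h ∧ h.natDegree = d - 1 ∧ h.coeff 0 ≠ 0 ∧
      ((X + C t) * h).Monic ∧ ((X + C t) * h).natDegree = d ∧ ((X + C t) * h).coeff 0 = c := by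
  -- an irreducible monic `h` of degree `d − 1` with `h(0) ≠ 0`
  obtain ⟨h, hm, hirr, hdeg, h0⟩ : ∃ h : k[X], h.Monic ∧ Irreducible h ∧ h.natDegree = d - 1 ∧ h.coeff 0 ≠ 0 := by
    by_cases hd2 : d = 2
    · subst hd2
      exact ⟨X + C 1, monic_X_add_C 1, irreducible_of_degree_eq_one (degree_X_add_C 1), natDegree_X_add_C 1, by simp⟩
    · obtain ⟨h, hm, hirr, hdeg⟩ := exists_monic_irreducible_natDegree_eq k (d - 1) (by omega)
      exact ⟨h, hm, hirr, hdeg, coeff_zero_ne_zero_of_irreducible_of_two_le hirr (by omega)⟩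
  refine ⟨c / h.coeff 0, h, hm, hirr, hdeg, h0, (monic_X_add_C _).mul hm, ?_, ?_⟩
  · rw [(monic_X_add_C _).natDegree_mul hm, natDegree_X_add_C, hdeg]; omega
  · rw [mul_coeff_zero, coeff_add, coeff_X_zero, coeff_C_zero, zero_add, div_mul_cancel₀ _ h0]

/-- **A monic polynomial of degree `d` with NO ROOT and prescribed constant term** (`d = 2` or `4 ≤ d`, `c ≠ 0`): `(X² + bX + c₁) · h₂` with `h₂` irreducible of
degree `d − 2` (absent for `d = 2`) and `X² + bX + c₁` irreducible, `c₁ := c ∕ h₂(0)` (§3). [cite: LidlNiederreiter1997, Ch. 3 §2] -/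
theorem exists_monic_no_root_coeff_zero_eq {d : ℕ} (hd : d = 2 ∨ 4 ≤ d) {c : k} (hc : c ≠ 0) :
    ∃ g : k[X], g.Monic ∧ g.natDegree = d ∧ g.coeff 0 = c ∧ ∀ x : k, ¬ g.IsRoot x := by
  -- the cofactor `h₂`: `1` for `d = 2`, an irreducible of degree `d − 2 ≥ 2` otherwise; in both cases no root and `h₂(0) ≠ 0`
  obtain ⟨h₂, hm₂, hdeg₂, h₂0, hnr₂⟩ : ∃ h₂ : k[X], h₂.Monic ∧ h₂.natDegree = d - 2 ∧ h₂.coeff 0 ≠ 0 ∧ ∀ x : k, ¬ h₂.IsRoot x := by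
    rcases hd with rfl | hd4
    · exact ⟨1, monic_one, by simp, by simp, fun x hx => by simp [IsRoot] at hx⟩
    · obtain ⟨h, hm, hirr, hdeg⟩ := exists_monic_irreducible_natDegree_eq k (d - 2) (by omega)
      refine ⟨h, hm, hdeg, coeff_zero_ne_zero_of_irreducible_of_two_le hirr (by omega), fun x hx => ?_⟩
      have h1 := degree_eq_one_of_irreducible_of_root hirr hx
      have : h.natDegree = 1 := natDegree_eq_of_degree_eq_some h1
      omega
  obtain ⟨b, hq⟩ := exists_irreducible_X_sq_add_C_mul_X_add_C k (div_ne_zero hc h₂0)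
  set q : k[X] := X ^ 2 + C b * X + C (c / h₂.coeff 0) with hqdef
  have hqdeg : q.natDegree = 2 := by rw [hqdef]; compute_degree!
  have hqm : q.Monic := by
    rw [Monic, leadingCoeff, hqdeg, hqdef]; simp
  have hqnr : ∀ x : k, ¬ q.IsRoot x := fun x hx => by
    have h1 := degree_eq_one_of_irreducible_of_root hq hx
    have : q.natDegree = 1 := natDegree_eq_of_degree_eq_some h1
    omega
  refine ⟨q * h₂, hqm.mul hm₂, ?_, ?_, fun x hx => ?_⟩
  · rw [hqm.natDegree_mul hm₂, hqdeg, hdeg₂]; omega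
  · have hq0 : q.coeff 0 = c / h₂.coeff 0 := by rw [hqdef]; simp
    rw [mul_coeff_zero, hq0, div_mul_cancel₀ _ h₂0]
  · rw [IsRoot, eval_mul, mul_eq_zero] at hx
    rcases hx with hx | hx
    · exact hqnr x hx
    · exact hnr₂ x hx

end Targets

/-! ## §5 The two-prime degree sieve over `ℤ` -/

/-- **Two-prime degree sieve.**  Let `f ∈ ℤ[X]` be monic of degree `d ≥ 2`.  If modulo a prime `ℓ₁` it factors as `l · h` with `l` monic linear and `h` IRREDUCIBLE,
and modulo a prime `ℓ₂` it has NO ROOT, then `f` is irreducible in `ℤ[X]`: in a monic factorisation `f = a b` over `ℤ` the prime `h̄ ∣ ā b̄` divides one factor,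
which then has degree `≥ d − 1`, so the other factor is monic LINEAR `X + C r`, and `−r` is an integer root of `f` — visible modulo `ℓ₂`. [folklore] -/
theorem irreducible_of_map_eq_linear_mul_irreducible_of_forall_not_isRoot {f : ℤ[X]} (hf : f.Monic) {d : ℕ} (hfd : f.natDegree = d) (hd : 2 ≤ d)
    {ℓ₁ : ℕ} [Fact ℓ₁.Prime] (l h : (ZMod ℓ₁)[X]) (hl : l.Monic) (hl1 : l.natDegree = 1) (hh : Irreducible h)
    (h₁ : f.map (Int.castRingHom (ZMod ℓ₁)) = l * h)
    {ℓ₂ : ℕ} [Fact ℓ₂.Prime] (h₂ : ∀ x : ZMod ℓ₂, ¬ (f.map (Int.castRingHom (ZMod ℓ₂))).IsRoot x) : Irreducible f := by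
  -- the degree of `h` is `d − 1`
  have hmapdeg : (f.map (Int.castRingHom (ZMod ℓ₁))).natDegree = d := by rw [hf.natDegree_map, hfd]
  have hh0 : h ≠ 0 := hh.ne_zero
  have hhdeg : h.natDegree = d - 1 := by
    have := congrArg natDegree h₁
    rw [hmapdeg, hl.natDegree_mul' hh0, hl1] at this
    omega
  -- no integer root (seen modulo `ℓ₂`)
  have hnoroot : ∀ r : ℤ, ¬ f.IsRoot r := fun r hr =>
    h₂ (Int.castRingHom (ZMod ℓ₂) r) (by rw [IsRoot, eval_map, eval₂_hom, hr.eq_zero, map_zero])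
  rw [hf.irreducible_iff_natDegree]
  refine ⟨fun h1 => by rw [h1, natDegree_one] at hfd; omega, fun a b ha hb hab => ?_⟩
  -- degrees of a monic factorisation
  have hdeg : a.natDegree + b.natDegree = d := by rw [← ha.natDegree_mul hb, hab, hfd]
  by_contra hcon
  push Not at hcon
  obtain ⟨ha0, hb0⟩ := hcon
  -- reduce mod `ℓ₁`: `h` divides `ā` or `b̄`
  have hprime : Prime h := hh.prime
  have hdvd : h ∣ a.map (Int.castRingHom (ZMod ℓ₁)) * b.map (Int.castRingHom (ZMod ℓ₁)) := by
    rw [← Polynomial.map_mul, hab, h₁]; exact dvd_mul_left h l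
  have hma : (a.map (Int.castRingHom (ZMod ℓ₁))).natDegree = a.natDegree := ha.natDegree_map _
  have hmb : (b.map (Int.castRingHom (ZMod ℓ₁))).natDegree = b.natDegree := hb.natDegree_map _
  -- whichever factor `h` divides has degree `≥ d − 1`; the other one is linear
  have hlin : a.natDegree = 1 ∨ b.natDegree = 1 := by
    rcases hprime.dvd_or_dvd hdvd with hda | hdb
    · have := natDegree_le_of_dvd hda (ha.map _).ne_zero
      rw [hhdeg, hma] at this
      right; omega
    · have := natDegree_le_of_dvd hdb (hb.map _).ne_zero
      rw [hhdeg, hmb] at this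
      left; omega
  -- a monic linear factor `X + C r` gives the integer root `−r`
  rcases hlin with ha1 | hb1
  · have hax : a = X + C (a.coeff 0) := ha.eq_X_add_C ha1
    apply hnoroot (-a.coeff 0)
    rw [IsRoot, ← hab, eval_mul, hax]; simp
  · have hbx : b = X + C (b.coeff 0) := hb.eq_X_add_C hb1
    apply hnoroot (-b.coeff 0)
    rw [IsRoot, ← hab, eval_mul, hbx]; simp

/-- **The sieve, over `ℚ`** (Gauss's lemma via ★ P4 `irreducible_map_rat_of_monic_of_irreducible_map` pattern: Mathlib
`Monic.irreducible_iff_irreducible_map_fraction_map`). [folklore] -/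
theorem irreducible_map_rat_of_map_eq_linear_mul_irreducible_of_forall_not_isRoot {f : ℤ[X]} (hf : f.Monic) {d : ℕ} (hfd : f.natDegree = d) (hd : 2 ≤ d)
    {ℓ₁ : ℕ} [Fact ℓ₁.Prime] (l h : (ZMod ℓ₁)[X]) (hl : l.Monic) (hl1 : l.natDegree = 1) (hh : Irreducible h)
    (h₁ : f.map (Int.castRingHom (ZMod ℓ₁)) = l * h)
    {ℓ₂ : ℕ} [Fact ℓ₂.Prime] (h₂ : ∀ x : ZMod ℓ₂, ¬ (f.map (Int.castRingHom (ZMod ℓ₂))).IsRoot x) : Irreducible (f.map (Int.castRingHom ℚ)) := by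
  rw [← algebraMap_int_eq]
  exact (hf.irreducible_iff_irreducible_map_fraction_map (K := ℚ)).1
    (irreducible_of_map_eq_linear_mul_irreducible_of_forall_not_isRoot hf hfd hd l h hl hl1 hh h₁ h₂)

end Summit.HodgeConjecture.HodgeConjecture.R90.S3

end
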